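import Summits.FinalStateConjecture.FinalStateConjecture.Theorems.SwallowTheDatumParametricKerrBurialStubSiteMarginAux1
import Mathlib.Analysis.Calculus.ContDiff.Bounds
import Mathlib.Analysis.InnerProductSpace.Calculus
import HarnessLib

/-!
# Stub `stub_bulkAt` of crux `SwallowTheDatum.ParametricKerrBurial` (stmt-FinalStateConjecture-10052), line
# `receding-annulus-universal-collar` — part 1: helpers and the RING site of the Brill–Lindquist bulk (lead c2)

The bulk has level `A = 8`, a central puncture of weight `α₀` at the origin and a regular `N`-gon of `N` punctures of weight `α` at
radius `L`.  At a ring puncture `L ĉ_j` the pure pull-back reading at the pinned scale `s = b⁻²` (`b = 8 + α₀/L + αT_N/L` the value of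
the regular part there) is a `C²`-small perturbation of the exact weak-field Schwarzschild model `schwField (2αb)` (the corrected
site-reading lemma, hypothesis `hSR` = `stub_siteReadingShell`; the regular-part variation is controlled by the evaluation-shift Coulomb
bound, hypothesis `hCoul` = `stub_bulkCoulomb`), hence a Thm-1.7 site against the flat in-core by the site margin (hypothesis `hSM` =
`stub_siteMargin`).  All bricks enter as HYPOTHESES (their landed statements verbatim), so this file only imports the engine.

References: Brill–Lindquist, Phys. Rev. 131 (1963) 471; Mao–Oh–Tao arXiv:2308.13031 Thm 1.7, Rem 1.11.
-/

set_option linter.dupNamespace false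

noncomputable section

-- instance search through the nested operator types `E3 →L E3 →L ℝ` (norms of `iteratedFDeriv`s in `DevLE`)
set_option maxSynthPendingDepth 3

namespace Summit.FinalStateConjecture.FinalStateConjecture.Theorems.SwallowTheDatum.ParametricKerrBurial

open scoped Manifold ContDiff Topology BigOperators InnerProductSpace
open Bundle Set Filter Function MeasureTheory Literature.Geometry.Lorentzian
open Literature.Geometry.Lorentzian.MaoOhTao Literature.Geometry.Lorentzian.InitialDataSet


/-! ## §0 Small helpers -/

/-- Iterated derivatives of the zero field vanish. [folklore] -/
theorem norm_iteratedFDeriv_zeroField_le (m : ℕ) (x : E3) {s : ℝ} (hs : 0 ≤ s) :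
    ‖iteratedFDeriv ℝ m zeroField x‖ ≤ s := by
  have h : iteratedFDeriv ℝ m zeroField x = 0 := by
    unfold zeroField
    simp only [iteratedFDeriv_fun_zero, Pi.zero_apply]
  rw [h, norm_zero]
  exact hs

/-- A time-symmetric datum has vanishing coordinate reading `coordK`. [folklore] -/
theorem coordK_eq_zero_of_k {B : InitialDataSet (𝓡 3) E3} (hBk : ∀ y : E3, B.k y = 0) (y : E3) :
    B.coordK y = 0 := by
  ext v v'; simp [hBk]


/-- The pure pull-back `k`-reading of a time-symmetric datum is the zero field. [folklore] -/
theorem reading_coordK_eq_zeroField {B : InitialDataSet (𝓡 3) E3} (hBk : ∀ y : E3, B.k y = 0) (c : E3) (s t : ℝ) :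
    (fun y : E3 ↦ t • B.coordK (c + s • y)) = zeroField := by
  funext y
  unfold zeroField
  rw [coordK_eq_zero_of_k hBk, smul_zero]

/-- **Registered anchor of this support file** (`stub_bulkAtSitesRing_anchor`): a time-symmetric datum has vanishing coordinate
reading `coordK`. [folklore] -/
theorem stub_bulkAtSitesRing_anchor : ∀ (B : InitialDataSet (𝓡 3) E3), (∀ y : E3, B.k y = 0) → ∀ y : E3, B.coordK y = 0 :=
  fun _ h y ↦ coordK_eq_zero_of_k h y

/-! ## §1 The three kinds of sites (ring, centre, end) -/

-- Heartbeat budget of `bulkAt_ringSite`: the one-piece site computation below costs between 180 000 and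
-- 200 000 heartbeats against the tree of 2026-08-16 (measured: fails at `maxHeartbeats 180000` with the
-- declaration-level `whnf` timeout, passes at the default 200 000) and ran over the default in the
-- 2026-08-16 full build after upstream drift (`65:0: (deterministic) timeout at whnf`). Doubled for this
-- declaration only; the statement and proof are unchanged.
set_option maxHeartbeats 400000 in
/-- **Ring site.** At a ring puncture `L ĉ_j` the pure pull-back reading of the bulk at the pinned scale `s = b⁻²` satisfies the
Thm-1.7 hypothesis block against the flat in-core. [folklore] -/
theorem bulkAt_ringSite {η : ℝ → ℝ} {εo μo κ cdev m₁ K C₂ L α₀ α b b₀ T U V : ℝ} {N : ℕ} {ĉ : ℕ → E3}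
    {B : InitialDataSet (𝓡 3) E3}
    (hSM : ∀ (mIn mOut : ℝ), 0 ≤ mIn → 8 * mIn ≤ mOut → 0 < mOut → mOut ≤ m₁ →
      DevLE (schwField mIn) zeroField 1 2 (cdev * mIn) ∧
      ∃ sOut : ℝ, ∀ gOut : E3 → E3 →L[ℝ] E3 →L[ℝ] ℝ,
        ContDiffOn ℝ ∞ gOut {x : E3 | 16 < ‖x‖} →
        DevLE (fun x ↦ gOut x - schwField mOut x + (innerSL ℝ : E3 →L[ℝ] E3 →L[ℝ] ℝ)) zeroField 32 64 (κ * mOut) →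
        MOTHyp η εo μo (schwField mIn) zeroField gOut zeroField (cdev * mIn) sOut)
    (hSR : ∀ (b α W : ℝ) (c : E3) (w : E3 → ℝ) (B : InitialDataSet (𝓡 3) E3),
      0 < b → 0 < α → 2 * α * b ≤ 1 → 0 ≤ W → 256 * W ≤ 1 →
      (∀ y : E3, B.k y = 0) →
      ContDiffOn ℝ ∞ w (Metric.ball c (256 / b ^ 2)) → w c = 0 →
      (∀ m : ℕ, 1 ≤ m → m ≤ 2 → ∀ y ∈ Metric.ball c (256 / b ^ 2),
        ‖iteratedFDeriv ℝ m w y‖ ≤ W * b ^ (2 * m + 1)) →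
      (∀ y ∈ Metric.ball c (256 / b ^ 2), 8 / b ^ 2 < ‖y - c‖ →
        B.coordH y = (b + α / ‖y - c‖ + w y) ^ 4 • (innerSL ℝ : E3 →L[ℝ] E3 →L[ℝ] ℝ)) →
      ∀ yh : E3, 16 ≤ ‖yh‖ → ‖yh‖ ≤ 128 →
        ((b ^ 2)⁻¹) ^ 2 • B.coordK (c + (b ^ 2)⁻¹ • yh) = 0 ∧
        ∀ m : ℕ, m ≤ 2 → ‖iteratedFDeriv ℝ m
          (fun z : E3 ↦ ((b ^ 2)⁻¹) ^ 2 • B.coordH (c + (b ^ 2)⁻¹ • z) - schwField (2 * α * b) z) yh‖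
            ≤ K * W)
    (hCoul : ∀ (S : Finset ℕ) (p : ℕ → E3) (wgt d : ℕ → ℝ),
      (∀ i ∈ S, 0 ≤ wgt i) → (∀ i ∈ S, 0 < d i ∧ d i ≤ ‖p i‖) →
      ∀ w : E3, (∀ i ∈ S, ‖w‖ ≤ d i / 2) →
        |∑ i ∈ S, wgt i * ‖p i + w‖⁻¹ - ∑ i ∈ S, wgt i * ‖p i‖⁻¹| ≤ C₂ * ‖w‖ * ∑ i ∈ S, wgt i / d i ^ 2 ∧
        (∀ m : ℕ, 1 ≤ m → m ≤ 2 →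
          ‖iteratedFDeriv ℝ m (fun w : E3 ↦ ∑ i ∈ S, wgt i * ‖p i + w‖⁻¹) w‖ ≤ C₂ * ∑ i ∈ S, wgt i / d i ^ (m + 1)) ∧
        ContDiffAt ℝ ∞ (fun w : E3 ↦ ∑ i ∈ S, wgt i * ‖p i + w‖⁻¹) w)
    (hN : 4 ≤ N) (hĉ1 : ∀ k : ℕ, ‖ĉ k‖ = 1)
    (hchord : ∀ j k : ℕ, j < k → k < j + N → (4 : ℝ) / N ≤ ‖ĉ j - ĉ k‖)
    (hT : ∀ j ∈ Finset.Icc 1 N, ∑ k ∈ (Finset.Icc 1 N).erase j, ‖ĉ j - ĉ k‖⁻¹ = T)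
    (hU : ∀ j ∈ Finset.Icc 1 N, ∑ k ∈ (Finset.Icc 1 N).erase j, (‖ĉ j - ĉ k‖ ^ 2)⁻¹ = U)
    (hV : ∀ j ∈ Finset.Icc 1 N, ∑ k ∈ (Finset.Icc 1 N).erase j, (‖ĉ j - ĉ k‖ ^ 3)⁻¹ = V)
    (hL : 0 < L) (hα₀ : 0 < α₀) (hα : 0 < α) (hb : b = 8 + α₀ / L + α * T / L) (hb₀ : 0 < b₀) (hκ : 0 ≤ κ)
    (hC₂ : 0 ≤ C₂)
    (hm₁ : m₁ ≤ 1) (hmr : 2 * α * b ≤ m₁)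
    (hW1 : K * (C₂ * ((α₀ + α * U) / (L ^ 2 * b ^ 3) + (α₀ + α * V) / (L ^ 3 * b ^ 5))) ≤ κ * (2 * α * b))
    (hW2 : 256 * (C₂ * ((α₀ + α * U) / (L ^ 2 * b ^ 3) + (α₀ + α * V) / (L ^ 3 * b ^ 5))) ≤ 1)
    (hsep : 256 / b ^ 2 ≤ 2 * L / N) (hsep₀ : 256 / b₀ ^ 2 ≤ L / 2)
    (hBk : ∀ y : E3, B.k y = 0)
    (hBH : ∀ y : E3, (b₀ ^ 2)⁻¹ / 2 < ‖y‖ → (∀ k ∈ Finset.Icc 1 N, (b ^ 2)⁻¹ / 2 < ‖y - L • ĉ k‖) →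
      B.coordH y = (8 + α₀ / ‖y‖ + ∑ k ∈ Finset.Icc 1 N, α / ‖y - L • ĉ k‖) ^ 4 •
        (innerSL ℝ : E3 →L[ℝ] E3 →L[ℝ] ℝ)) :
    ∃ sOut : ℝ, ∀ j ∈ Finset.Icc 1 N,
      MOTHyp η εo μo flatField zeroField (fun y ↦ ((b ^ 2)⁻¹) ^ 2 • B.coordH (L • ĉ j + (b ^ 2)⁻¹ • y))
        (fun y ↦ ((b ^ 2)⁻¹) ^ 2 • B.coordK (L • ĉ j + (b ^ 2)⁻¹ • y)) 0 sOut := by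
  classical
  have hN0 : (0 : ℝ) < N := by exact_mod_cast (show 0 < N by omega)
  have hN4' : (4 : ℝ) ≤ N := by exact_mod_cast hN
  have hT0 : 0 ≤ T := by
    rw [← hT 1 (Finset.mem_Icc.2 ⟨le_rfl, by omega⟩)]; exact Finset.sum_nonneg fun k _ ↦ by positivity
  have hU0 : 0 ≤ U := by
    rw [← hU 1 (Finset.mem_Icc.2 ⟨le_rfl, by omega⟩)]; exact Finset.sum_nonneg fun k _ ↦ by positivity
  have hV0 : 0 ≤ V := by
    rw [← hV 1 (Finset.mem_Icc.2 ⟨le_rfl, by omega⟩)]; exact Finset.sum_nonneg fun k _ ↦ by positivity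
  have hbpos : 0 < b := by
    have : 0 ≤ α₀ / L + α * T / L := by positivity
    rw [hb]; linarith
  have hb2 : 0 < b ^ 2 := by positivity
  -- elementary consequences of the separation hypotheses
  have hLN2 : 2 * L / N ≤ L / 2 := by
    rw [div_le_div_iff₀ hN0 two_pos]; nlinarith
  have hsmall : (b ^ 2)⁻¹ / 2 < 8 / b ^ 2 := by
    rw [inv_eq_one_div, div_div, div_lt_div_iff₀ (by positivity) hb2]; nlinarith
  have hsmall' : (8 : ℝ) / b ^ 2 < 256 / b ^ 2 := div_lt_div_of_pos_right (by norm_num) hb2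
  have hs₀L : (b₀ ^ 2)⁻¹ / 2 < L / 2 := by
    have h1 : (b₀ ^ 2)⁻¹ = (256 / b₀ ^ 2) / 256 := by rw [inv_eq_one_div]; field_simp
    rw [h1]; linarith [hsep₀, hL]
  -- the site mass and the site margin
  have hmr0 : 0 < 2 * α * b := by positivity
  obtain ⟨-, sOut, hMO⟩ := hSM 0 (2 * α * b) le_rfl (by linarith) hmr0 hmr
  refine ⟨sOut, fun j hj ↦ ?_⟩
  -- the size `W` of the regular-part variation
  obtain ⟨W, hW_def⟩ : ∃ W : ℝ, W = C₂ * ((α₀ + α * U) / (L ^ 2 * b ^ 3) + (α₀ + α * V) / (L ^ 3 * b ^ 5)) := ⟨_, rfl⟩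
  have hW0 : 0 ≤ W := by rw [hW_def]; positivity
  have hW1' : K * W ≤ κ * (2 * α * b) := by rw [hW_def]; exact hW1
  have hW2' : 256 * W ≤ 1 := by rw [hW_def]; exact hW2
  -- chord lengths between distinct ring indices
  have hdist : ∀ i ∈ (Finset.Icc 1 N).erase j, (4 : ℝ) / N ≤ ‖ĉ j - ĉ i‖ := by
    intro i hi
    obtain ⟨hij, hi'⟩ := Finset.mem_erase.1 hi
    obtain ⟨hi1, hiN⟩ := Finset.mem_Icc.1 hi'
    obtain ⟨hj1, hjN⟩ := Finset.mem_Icc.1 hj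
    rcases lt_or_gt_of_ne hij with h | h
    · rw [norm_sub_rev]; exact hchord i j h (by omega)
    · exact hchord j i h (by omega)
  have hdistL : ∀ i ∈ (Finset.Icc 1 N).erase j, 4 * L / N ≤ L * ‖ĉ j - ĉ i‖ := by
    intro i hi
    have h4 : (4 : ℝ) ≤ ‖ĉ j - ĉ i‖ * N := by have := hdist i hi; rwa [div_le_iff₀ hN0] at this
    rw [div_le_iff₀ hN0]; nlinarith
  -- the Coulomb data of the site (opaque, with unfolding equations)
  obtain ⟨S, hS⟩ : ∃ S : Finset ℕ, S = insert 0 ((Finset.Icc 1 N).erase j) := ⟨_, rfl⟩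
  obtain ⟨p, hp0, hp⟩ : ∃ p : ℕ → E3, p 0 = L • ĉ j ∧ ∀ i, i ≠ 0 → p i = L • ĉ j - L • ĉ i :=
    ⟨fun i ↦ if i = 0 then L • ĉ j else L • ĉ j - L • ĉ i, if_pos rfl, fun i hi ↦ if_neg hi⟩
  obtain ⟨wgt, hwgt0, hwgt⟩ : ∃ wgt : ℕ → ℝ, wgt 0 = α₀ ∧ ∀ i, i ≠ 0 → wgt i = α :=
    ⟨fun i ↦ if i = 0 then α₀ else α, if_pos rfl, fun i hi ↦ if_neg hi⟩
  obtain ⟨d, hd0, hd⟩ : ∃ d : ℕ → ℝ, d 0 = L ∧ ∀ i, i ≠ 0 → d i = L * ‖ĉ j - ĉ i‖ :=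
    ⟨fun i ↦ if i = 0 then L else L * ‖ĉ j - ĉ i‖, if_pos rfl, fun i hi ↦ if_neg hi⟩
  obtain ⟨G, hG⟩ : ∃ G : E3 → ℝ, G = fun v ↦ ∑ i ∈ S, wgt i * ‖p i + v‖⁻¹ := ⟨_, rfl⟩
  have h0S : (0 : ℕ) ∉ (Finset.Icc 1 N).erase j := by simp
  have hne0 : ∀ i ∈ (Finset.Icc 1 N).erase j, i ≠ 0 := by rintro i hi rfl; exact h0S hi
  have hwgtS : ∀ i ∈ S, 0 ≤ wgt i := by
    intro i hi
    rw [hS, Finset.mem_insert] at hi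
    rcases hi with rfl | hi
    · rw [hwgt0]; exact hα₀.le
    · rw [hwgt i (hne0 i hi)]; exact hα.le
  have hdp : ∀ i ∈ S, 0 < d i ∧ d i ≤ ‖p i‖ := by
    intro i hi
    rw [hS, Finset.mem_insert] at hi
    rcases hi with rfl | hi
    · rw [hd0, hp0, norm_smul, Real.norm_of_nonneg hL.le, hĉ1, mul_one]; exact ⟨hL, le_rfl⟩
    · rw [hd i (hne0 i hi), hp i (hne0 i hi), ← smul_sub, norm_smul, Real.norm_of_nonneg hL.le]
      exact ⟨mul_pos hL (lt_of_lt_of_le (by positivity) (hdist i hi)), le_rfl⟩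
  have hdhalf : ∀ v : E3, ‖v‖ < 256 / b ^ 2 → ∀ i ∈ S, ‖v‖ ≤ d i / 2 := by
    intro v hv i hi
    have hv' : ‖v‖ ≤ 2 * L / N := hv.le.trans hsep
    rw [hS, Finset.mem_insert] at hi
    rcases hi with rfl | hi
    · rw [hd0]; linarith
    · rw [hd i (hne0 i hi)]
      have := hdistL i hi
      have h7 : (4 : ℝ) * L / N = 2 * L / N + 2 * L / N := by ring
      linarith
  -- the Coulomb sums of the site
  have hsum : ∀ m : ℕ, ∑ i ∈ S, wgt i / d i ^ (m + 1) =
      (α₀ + α * ∑ k ∈ (Finset.Icc 1 N).erase j, (‖ĉ j - ĉ k‖ ^ (m + 1))⁻¹) / L ^ (m + 1) := by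
    intro m
    rw [hS, Finset.sum_insert h0S, hwgt0, hd0, add_div, Finset.mul_sum, Finset.sum_div]
    congr 1
    refine Finset.sum_congr rfl fun i hi ↦ ?_
    have hci : 0 < ‖ĉ j - ĉ i‖ := lt_of_lt_of_le (by positivity) (hdist i hi)
    rw [hwgt i (hne0 i hi), hd i (hne0 i hi), mul_pow]
    field_simp
  -- the regular part `w` of the conformal factor at the site
  obtain ⟨w, hw⟩ : ∃ w : E3 → ℝ, w = fun y ↦ G (y - L • ĉ j) - (α₀ / L + α * T / L) := ⟨_, rfl⟩
  have hGsum : ∀ y : E3, G (y - L • ĉ j) = α₀ / ‖y‖ + ∑ k ∈ (Finset.Icc 1 N).erase j, α / ‖y - L • ĉ k‖ := by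
    intro y
    rw [hG]; dsimp only
    rw [hS, Finset.sum_insert h0S, hwgt0, hp0, add_sub_cancel, div_eq_mul_inv]
    congr 1
    refine Finset.sum_congr rfl fun i hi ↦ ?_
    rw [hwgt i (hne0 i hi), hp i (hne0 i hi), div_eq_mul_inv]
    congr 2
    abel
  have hident : ∀ y : E3, 8 + α₀ / ‖y‖ + ∑ k ∈ Finset.Icc 1 N, α / ‖y - L • ĉ k‖ =
      b + α / ‖y - L • ĉ j‖ + w y := by
    intro y
    rw [hw]; dsimp only
    rw [hGsum y, hb, ← Finset.add_sum_erase _ _ hj]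
    ring
  have hringT : ∑ k ∈ (Finset.Icc 1 N).erase j, α / ‖L • ĉ j - L • ĉ k‖ = α * T / L := by
    rw [← hT j hj, Finset.mul_sum, Finset.sum_div]
    refine Finset.sum_congr rfl fun i hi ↦ ?_
    have hci : 0 < ‖ĉ j - ĉ i‖ := lt_of_lt_of_le (by positivity) (hdist i hi)
    rw [← smul_sub, norm_smul, Real.norm_of_nonneg hL.le]
    field_simp
  have hw0 : w (L • ĉ j) = 0 := by
    rw [hw]; dsimp only
    rw [hGsum (L • ĉ j), norm_smul, Real.norm_of_nonneg hL.le, hĉ1, mul_one, hringT]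
    ring
  -- smoothness of `w` on the reading ball and its derivative bounds
  have hGat : ∀ y ∈ Metric.ball (L • ĉ j) (256 / b ^ 2), ContDiffAt ℝ ∞ G (y - L • ĉ j) ∧
      ∀ m : ℕ, 1 ≤ m → m ≤ 2 → ‖iteratedFDeriv ℝ m G (y - L • ĉ j)‖ ≤ C₂ * ∑ i ∈ S, wgt i / d i ^ (m + 1) := by
    intro y hy
    have hv : ‖y - L • ĉ j‖ < 256 / b ^ 2 := by rwa [Metric.mem_ball, dist_eq_norm] at hy
    have h := hCoul S p wgt d hwgtS hdp (y - L • ĉ j) (hdhalf _ hv)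
    rw [hG]
    exact ⟨h.2.2, h.2.1⟩
  have hGc : ∀ y ∈ Metric.ball (L • ĉ j) (256 / b ^ 2), ContDiffAt ℝ ∞ (fun z ↦ G (z - L • ĉ j)) y :=
    fun y hy ↦ (hGat y hy).1.comp y (contDiffAt_id.sub contDiffAt_const)
  have hwC : ContDiffOn ℝ ∞ w (Metric.ball (L • ĉ j) (256 / b ^ 2)) := by
    intro y hy
    rw [hw]
    exact ((hGc y hy).sub contDiffAt_const).contDiffWithinAt
  have hwb : ∀ m : ℕ, 1 ≤ m → m ≤ 2 → ∀ y ∈ Metric.ball (L • ĉ j) (256 / b ^ 2),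
      ‖iteratedFDeriv ℝ m w y‖ ≤ W * b ^ (2 * m + 1) := by
    intro m hm1 hm2 y hy
    have hGy := hGat y hy
    have hder : iteratedFDeriv ℝ m w y = iteratedFDeriv ℝ m G (y - L • ĉ j) := by
      have e1 : w = (fun z ↦ G (z - L • ĉ j)) - fun _ ↦ (α₀ / L + α * T / L) := by rw [hw]; rfl
      have hGm : ContDiffAt ℝ m (fun z ↦ G (z - L • ĉ j)) y := (hGc y hy).of_le (by exact_mod_cast le_top)
      rw [e1, iteratedFDeriv_sub_apply hGm contDiffAt_const, iteratedFDeriv_const_of_ne (by omega), Pi.zero_apply,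
        sub_zero, iteratedFDeriv_comp_sub]
    rw [hder]
    refine (hGy.2 m hm1 hm2).trans ?_
    rw [hsum m]
    have hb3 : 0 < b ^ 3 := by positivity
    have hb5 : 0 < b ^ 5 := by positivity
    rcases (show m = 1 ∨ m = 2 by omega) with rfl | rfl
    · rw [hU j hj]
      have e : C₂ * ((α₀ + α * U) / L ^ (1 + 1)) = C₂ * ((α₀ + α * U) / (L ^ 2 * b ^ 3)) * b ^ (2 * 1 + 1) := by
        field_simp
      rw [e]
      refine mul_le_mul_of_nonneg_right ?_ hb3.le
      have : 0 ≤ C₂ * ((α₀ + α * V) / (L ^ 3 * b ^ 5)) := by positivity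
      rw [hW_def, mul_add]; linarith
    · rw [hV j hj]
      have e : C₂ * ((α₀ + α * V) / L ^ (2 + 1)) = C₂ * ((α₀ + α * V) / (L ^ 3 * b ^ 5)) * b ^ (2 * 2 + 1) := by
        field_simp
      rw [e]
      refine mul_le_mul_of_nonneg_right ?_ hb5.le
      have : 0 ≤ C₂ * ((α₀ + α * U) / (L ^ 2 * b ^ 3)) := by positivity
      rw [hW_def, mul_add]; linarith
  -- the bulk formula on the reading shell
  have hform : ∀ y ∈ Metric.ball (L • ĉ j) (256 / b ^ 2), 8 / b ^ 2 < ‖y - L • ĉ j‖ →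
      B.coordH y = (b + α / ‖y - L • ĉ j‖ + w y) ^ 4 • (innerSL ℝ : E3 →L[ℝ] E3 →L[ℝ] ℝ) := by
    intro y hy h8
    have hv : ‖y - L • ĉ j‖ < 256 / b ^ 2 := by rwa [Metric.mem_ball, dist_eq_norm] at hy
    have hv2 : ‖y - L • ĉ j‖ ≤ 2 * L / N := hv.le.trans hsep
    have htri : L ≤ ‖y‖ + ‖y - L • ĉ j‖ := by
      have : ‖L • ĉ j‖ ≤ ‖y‖ + ‖y - L • ĉ j‖ := by
        calc ‖L • ĉ j‖ = ‖y - (y - L • ĉ j)‖ := by rw [sub_sub_cancel]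
          _ ≤ ‖y‖ + ‖y - L • ĉ j‖ := norm_sub_le _ _
      rwa [norm_smul, Real.norm_of_nonneg hL.le, hĉ1, mul_one] at this
    have hy0 : (b₀ ^ 2)⁻¹ / 2 < ‖y‖ := by linarith
    have hyk : ∀ k ∈ Finset.Icc 1 N, (b ^ 2)⁻¹ / 2 < ‖y - L • ĉ k‖ := by
      intro k hk
      by_cases hkj : k = j
      · rw [hkj]; exact hsmall.trans h8
      · have hk' : k ∈ (Finset.Icc 1 N).erase j := Finset.mem_erase.2 ⟨hkj, hk⟩
        have htri' : L * ‖ĉ j - ĉ k‖ ≤ ‖y - L • ĉ k‖ + ‖y - L • ĉ j‖ := by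
          have : ‖L • ĉ j - L • ĉ k‖ ≤ ‖y - L • ĉ k‖ + ‖y - L • ĉ j‖ := by
            calc ‖L • ĉ j - L • ĉ k‖ = ‖(y - L • ĉ k) - (y - L • ĉ j)‖ := by rw [sub_sub_sub_cancel_left]
              _ ≤ ‖y - L • ĉ k‖ + ‖y - L • ĉ j‖ := norm_sub_le _ _
          rwa [← smul_sub, norm_smul, Real.norm_of_nonneg hL.le] at this
        have h5 := hdistL k hk'
        have h7 : (4 : ℝ) * L / N = 2 * L / N + 2 * L / N := by ring
        linarith [hsmall, hsmall']
    rw [hBH y hy0 hyk, hident y]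
  -- the reading is `K W`-close to `schwField (2αb)`; feed the site margin
  obtain ⟨gH, hgH⟩ : ∃ gH : E3 → E3 →L[ℝ] E3 →L[ℝ] ℝ,
      gH = fun y ↦ ((b ^ 2)⁻¹) ^ 2 • B.coordH (L • ĉ j + (b ^ 2)⁻¹ • y) := ⟨_, rfl⟩
  have hread := hSR b α W (L • ĉ j) w B hbpos hα (by linarith) hW0 hW2' hBk hwC hw0 hwb hform
  have hgHs : ContDiffOn ℝ ∞ gH {x : E3 | 16 < ‖x‖} := by
    have h1 : ContDiff ℝ ∞ B.coordH := B.contMDiff_coordH.contDiff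
    have h2 : ContDiff ℝ ∞ fun y : E3 ↦ L • ĉ j + (b ^ 2)⁻¹ • y :=
      contDiff_const.add (contDiff_id.const_smul ((b ^ 2)⁻¹))
    rw [hgH]
    exact ((h1.comp h2).const_smul (((b ^ 2)⁻¹) ^ 2)).contDiffOn
  have hclose : DevLE (fun x ↦ gH x - schwField (2 * α * b) x + (innerSL ℝ : E3 →L[ℝ] E3 →L[ℝ] ℝ)) zeroField 32 64
      (κ * (2 * α * b)) := by
    intro x hx1 hx2
    refine ⟨fun m hm ↦ ?_, fun m _ ↦ ?_⟩
    · have e1 : (fun y ↦ gH y - schwField (2 * α * b) y + (innerSL ℝ : E3 →L[ℝ] E3 →L[ℝ] ℝ) -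
          (innerSL ℝ : E3 →L[ℝ] E3 →L[ℝ] ℝ)) =
          fun z ↦ ((b ^ 2)⁻¹) ^ 2 • B.coordH (L • ĉ j + (b ^ 2)⁻¹ • z) - schwField (2 * α * b) z := by
        funext y; rw [hgH, add_sub_cancel_right]
      refine le_trans (le_of_eq ?_) (((hread x (by linarith) (by linarith)).2 m hm).trans hW1')
      rw [e1]
    · exact norm_iteratedFDeriv_zeroField_le m x (by positivity)
  have hM := hMO gH hgHs hclose
  -- rewrite the flat in-data and the (vanishing) `k`-reading
  rw [sm_schwField_zero, mul_zero, hgH] at hM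
  rw [reading_coordK_eq_zeroField hBk (L • ĉ j) ((b ^ 2)⁻¹) (((b ^ 2)⁻¹) ^ 2)]
  exact hM


end Summit.FinalStateConjecture.FinalStateConjecture.Theorems.SwallowTheDatum.ParametricKerrBurial

end
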